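import Literature.Analysis.SpecialFunctions.JacobiThetaSupBound
import HarnessLib

/-!
# Lattice Gaussian sums in `g` variables:
# `Σ_{n ∈ ℤ^g} e^{-π ᵗ(n+b) Y (n+b)} ≤ 2^g (1 + 2/(π√3 c))^g`
# (Javanpeykar 2014, Lemma 2.4.2, inequality (2.4.2), the `g`-dimensional majorant)

Topic `Analysis/SpecialFunctions`; sequel of `JacobiThetaSupBound.lean` (the case `g = 1` for
Mathlib's `jacobiTheta₂`, and the one-variable estimate `tsum_exp_neg_mul_sq_le`:
`Σ_{n ∈ ℤ} e^{-a(n+b)²} ≤ 2/(1 - e^{-a})`). The proof of [Javanpeykar2014, Lemma 2.4.2] bounds the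
Riemann theta function in genus `g`, for `τ` in the Siegel fundamental domain and `z = x + iy`,
`y = Im τ · b`, by

> `exp(-π ᵗy (Im τ)⁻¹ y) |ϑ(z;τ)| ≤ Σ_{n ∈ ℤ^g} exp(-π ᵗ(n+b) Im τ (n+b))`
> `≤ Σ_{n ∈ ℤ^g} exp(-Σᵢ π c(g) (nᵢ+bᵢ)² (Im τ)ᵢᵢ) ≤ ∏ᵢ Σ_{nᵢ ∈ ℤ} exp(-π c(g)(nᵢ+bᵢ)²(Im τ)ᵢᵢ)`
> `≤ ∏ᵢ 2/(1 - exp(-π c(g) (Im τ)ᵢᵢ)) ≤ 2^g (1 + 2/(π√3 c(g)))^g`,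

using the two consequences of Minkowski reduction quoted from Igusa:
`ᵗm Im(τ) m ≥ c(g) Σᵢ mᵢ² (Im τ)ᵢᵢ` and `(Im τ)ᵢᵢ ≥ √3/2`. We prove this chain of inequalities for
an arbitrary real `g × g` matrix `Y` (in place of `Im τ`) satisfying these two hypotheses with an
arbitrary constant `c > 0`:

* `summable_tsum_pi_prod` — Fubini for product functions: `Σ_{n : Fin k → β} ∏ᵢ fᵢ(nᵢ) = ∏ᵢ Σ fᵢ`
  for non-negative summable real `fᵢ` (induction on `k` via `Fin.consEquiv` and Mathlib's
  `Summable.tsum_mul_tsum`);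
* `tsum_exp_neg_quadratic_le` — summability of `Σ_{n ∈ ℤ^g} exp(-π ᵗ(n+b) Y (n+b))` and the bound
  `≤ ∏ᵢ 2/(1 - exp(-π c Yᵢᵢ))` (`Yᵢᵢ > 0`);
* `tsum_exp_neg_quadratic_le_pow` — with `Yᵢᵢ ≥ √3/2`: **`≤ (2 (1 + 2/(π √3 c)))^g`**
  (`two_div_one_sub_exp_neg_le`: `2/(1 - e^{-a}) ≤ 2(1 + 1/a)`).

Not here: the Riemann theta function in `g ≥ 2` variables and Siegel/Minkowski reduction themselves
(absent from Mathlib), hence neither the first inequality of the chain nor the value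
`c(g) = (4/g³)^{g-1} (3/4)^{g(g-1)/2}` and the final `2^{3g³+5g}`. Theorems only; no definition, no
named fact.

## References

* A. Javanpeykar, *Polynomial bounds for Arakelov invariants of Belyi curves* (appendix by
  P. Bruin), Algebra & Number Theory 8 (2014), no. 1, 89–140, doi:10.2140/ant.2014.8.89,
  arXiv:1403.6404: Lemma 2.4.2 and its proof, inequality (2.4.2). [Javanpeykar2014]
* J.-I. Igusa, *Theta Functions*, Springer (1972), Ch. V §4, Lemma 15 and its corollary
  (the reduction inequalities quoted in the printed proof).
-/

noncomputable section

open Real Filter Topology Finset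

namespace Literature.Analysis.SpecialFunctions

/-! ### Fubini for product functions on `Fin k → β` -/

/-- **`Σ_{n : Fin k → β} ∏ᵢ fᵢ(nᵢ) = ∏ᵢ Σ_m fᵢ(m)`** for non-negative summable real `fᵢ`
(with summability of the left-hand side). [folklore] -/
theorem summable_tsum_pi_prod {β : Type*} :
    ∀ {k : ℕ} (f : Fin k → β → ℝ), (∀ i m, 0 ≤ f i m) → (∀ i, Summable (f i)) →
      Summable (fun n : Fin k → β ↦ ∏ i, f i (n i)) ∧
        ∑' n : Fin k → β, ∏ i, f i (n i) = ∏ i, ∑' m, f i m := by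
  intro k
  induction k with
  | zero =>
    intro f _ _
    refine ⟨?_, ?_⟩
    · exact (hasSum_fintype _).summable
    · simp [tsum_fintype]
  | succ k ih =>
    intro f h0 hs
    -- split off the coordinate `0`
    set F : β → ℝ := f 0 with hF
    set G : (Fin k → β) → ℝ := fun v ↦ ∏ i : Fin k, f i.succ (v i) with hG
    obtain ⟨hGs, hGt⟩ := ih (fun i ↦ f i.succ) (fun i m ↦ h0 _ m) (fun i ↦ hs _)
    have hFs : Summable F := hs 0
    have hF0 : 0 ≤ F := fun m ↦ h0 0 m
    have hG0 : 0 ≤ G := fun v ↦ Finset.prod_nonneg fun i _ ↦ h0 _ _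
    have hFG : Summable fun x : β × (Fin k → β) ↦ F x.1 * G x.2 := hFs.mul_of_nonneg hGs hF0 hG0
    -- transport along `Fin.consEquiv : β × (Fin k → β) ≃ (Fin (k+1) → β)`
    set e : β × (Fin k → β) ≃ (Fin (k + 1) → β) := Fin.consEquiv (fun _ : Fin (k + 1) ↦ β)
      with he
    have hcomp : (fun n : Fin (k + 1) → β ↦ ∏ i, f i (n i)) ∘ e =
        (fun x : β × (Fin k → β) ↦ F x.1 * G x.2) := by
      funext x
      simp only [Function.comp_apply, he, Fin.consEquiv_apply, hF, hG, Fin.prod_univ_succ,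
        Fin.cons_zero, Fin.cons_succ]
    refine ⟨?_, ?_⟩
    · rw [← e.summable_iff, hcomp]
      exact hFG
    · rw [← e.tsum_eq, show (fun n ↦ (fun n : Fin (k + 1) → β ↦ ∏ i, f i (n i)) (e n)) =
          (fun n : Fin (k + 1) → β ↦ ∏ i, f i (n i)) ∘ e from rfl, hcomp,
        ← hFs.tsum_mul_tsum hGs hFG, hGt, Fin.prod_univ_succ]

/-! ### The Gaussian lattice sum under Minkowski-type reduction hypotheses -/

/-- For `a > 0`: `2/(1 - e^{-a}) ≤ 2 (1 + 1/a)` (from `e^{-a} ≤ 1/(1 + a)`). [folklore] -/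
theorem two_div_one_sub_exp_neg_le {a : ℝ} (ha : 0 < a) :
    2 / (1 - rexp (-a)) ≤ 2 * (1 + 1 / a) := by
  have h1 : rexp (-a) ≤ 1 / (1 + a) := by
    rw [Real.exp_neg, one_div]
    exact inv_anti₀ (by linarith) (by linarith [Real.add_one_le_exp a])
  have hlt : rexp (-a) < 1 := exp_lt_one_iff.mpr (by linarith)
  rw [div_le_iff₀ (by linarith)]
  have : 1 - 1 / (1 + a) ≤ 1 - rexp (-a) := by linarith
  have h2 : 2 * (1 + 1 / a) * (1 - 1 / (1 + a)) = 2 := by field_simp; ring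
  nlinarith [h2, mul_le_mul_of_nonneg_left this (by positivity : (0 : ℝ) ≤ 2 * (1 + 1 / a))]

/-- **The majorant of Javanpeykar 2014, Lemma 2.4.2, in `g` variables.** Let `Y` be a real
`g × g` matrix (the imaginary part of a period matrix) and `c > 0` with
`ᵗm Y m ≥ c Σᵢ mᵢ² Yᵢᵢ` for all real `m` (Minkowski reduction, `c = c(g)`) and `Yᵢᵢ > 0`. Then for
every `b ∈ ℝ^g` the series `Σ_{n ∈ ℤ^g} exp(-π ᵗ(n+b) Y (n+b))` converges and is at most
`∏ᵢ 2/(1 - exp(-π c Yᵢᵢ))`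
("`≤ Σ_n exp(-Σᵢ π c (nᵢ + bᵢ)² Yᵢᵢ) ≤ ∏ᵢ Σ_{nᵢ ∈ ℤ} exp(-π c (nᵢ+bᵢ)² Yᵢᵢ)
≤ ∏ᵢ 2/(1 - exp(-π c Yᵢᵢ))`"). [cite: Javanpeykar2014, Lemma 2.4.2 (proof)] -/
theorem tsum_exp_neg_quadratic_le {g : ℕ} (Y : Matrix (Fin g) (Fin g) ℝ) {c : ℝ} (hc : 0 < c)
    (hY : ∀ m : Fin g → ℝ, c * ∑ i, m i ^ 2 * Y i i ≤ ∑ i, ∑ j, m i * Y i j * m j)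
    (hdiag : ∀ i, 0 < Y i i) (b : Fin g → ℝ) :
    Summable (fun n : Fin g → ℤ ↦
        rexp (-(π * ∑ i, ∑ j, ((n i : ℝ) + b i) * Y i j * ((n j : ℝ) + b j)))) ∧
      ∑' n : Fin g → ℤ, rexp (-(π * ∑ i, ∑ j, ((n i : ℝ) + b i) * Y i j * ((n j : ℝ) + b j))) ≤
        ∏ i, 2 / (1 - rexp (-(π * c * Y i i))) := by
  -- the one-variable majorants
  set f : Fin g → ℤ → ℝ := fun i m ↦ rexp (-(π * c * Y i i * ((m : ℝ) + b i) ^ 2)) with hf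
  have hf0 : ∀ i m, 0 ≤ f i m := fun i m ↦ (exp_pos _).le
  have ha : ∀ i, 0 < π * c * Y i i := fun i ↦ mul_pos (mul_pos pi_pos hc) (hdiag i)
  have h1d : ∀ i, Summable (f i) ∧ ∑' m, f i m ≤ 2 / (1 - rexp (-(π * c * Y i i))) :=
    fun i ↦ tsum_exp_neg_mul_sq_le (ha i) (b i)
  obtain ⟨hFs, hFt⟩ := summable_tsum_pi_prod f hf0 (fun i ↦ (h1d i).1)
  -- termwise comparison with the product of the majorants
  have hle : ∀ n : Fin g → ℤ,
      rexp (-(π * ∑ i, ∑ j, ((n i : ℝ) + b i) * Y i j * ((n j : ℝ) + b j))) ≤ ∏ i, f i (n i) := by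
    intro n
    simp only [hf]
    rw [← Real.exp_sum, exp_le_exp]
    have h := hY (fun i ↦ (n i : ℝ) + b i)
    have e1 : ∑ x, -(π * c * Y x x * ((n x : ℝ) + b x) ^ 2) =
        -(π * (c * ∑ i, ((n i : ℝ) + b i) ^ 2 * Y i i)) := by
      rw [Finset.mul_sum, Finset.mul_sum, ← Finset.sum_neg_distrib]
      exact Finset.sum_congr rfl fun i _ ↦ by ring
    rw [e1, neg_le_neg_iff]
    exact mul_le_mul_of_nonneg_left h pi_pos.le
  have hpos : ∀ n : Fin g → ℤ,
      0 ≤ rexp (-(π * ∑ i, ∑ j, ((n i : ℝ) + b i) * Y i j * ((n j : ℝ) + b j))) :=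
    fun n ↦ (exp_pos _).le
  have hS : Summable (fun n : Fin g → ℤ ↦
      rexp (-(π * ∑ i, ∑ j, ((n i : ℝ) + b i) * Y i j * ((n j : ℝ) + b j)))) :=
    Summable.of_nonneg_of_le hpos hle hFs
  refine ⟨hS, ?_⟩
  calc ∑' n : Fin g → ℤ, rexp (-(π * ∑ i, ∑ j, ((n i : ℝ) + b i) * Y i j * ((n j : ℝ) + b j)))
      ≤ ∑' n : Fin g → ℤ, ∏ i, f i (n i) := hS.tsum_le_tsum hle hFs
    _ = ∏ i, ∑' m, f i m := hFt
    _ ≤ ∏ i, 2 / (1 - rexp (-(π * c * Y i i))) :=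
        Finset.prod_le_prod (fun i _ ↦ tsum_nonneg (hf0 i)) (fun i _ ↦ (h1d i).2)

/-- **Inequality (2.4.2) of Javanpeykar 2014, Lemma 2.4.2 — the explicit bound.** Under the same
hypotheses and `Yᵢᵢ ≥ √3/2` ("(Im τ)ᵢᵢ ≥ √3/2 for all i", Igusa), the lattice Gaussian sum is at
most `2^g (1 + 2/(π √3 c))^g` (each factor: `2/(1 - exp(-π c Yᵢᵢ)) ≤ 2 (1 + 1/(π c Yᵢᵢ)) ≤
2 (1 + 2/(π √3 c))`). With `c = c(g) = (4/g³)^{g-1} (3/4)^{g(g-1)/2}` the paper bounds this by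
`2^{3g³ + 5g}`. [cite: Javanpeykar2014, Lemma 2.4.2 (proof, (2.4.2))] -/
theorem tsum_exp_neg_quadratic_le_pow {g : ℕ} (Y : Matrix (Fin g) (Fin g) ℝ) {c : ℝ} (hc : 0 < c)
    (hY : ∀ m : Fin g → ℝ, c * ∑ i, m i ^ 2 * Y i i ≤ ∑ i, ∑ j, m i * Y i j * m j)
    (hdiag : ∀ i, Real.sqrt 3 / 2 ≤ Y i i) (b : Fin g → ℝ) :
    ∑' n : Fin g → ℤ, rexp (-(π * ∑ i, ∑ j, ((n i : ℝ) + b i) * Y i j * ((n j : ℝ) + b j))) ≤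
      (2 * (1 + 2 / (π * Real.sqrt 3 * c))) ^ g := by
  have h3 : 0 < Real.sqrt 3 / 2 := by positivity
  have hdiag' : ∀ i, 0 < Y i i := fun i ↦ h3.trans_le (hdiag i)
  refine (tsum_exp_neg_quadratic_le Y hc hY hdiag' b).2.trans ?_
  have hfac : ∀ i, 2 / (1 - rexp (-(π * c * Y i i))) ≤ 2 * (1 + 2 / (π * Real.sqrt 3 * c)) := by
    intro i
    have ha : 0 < π * c * Y i i := mul_pos (mul_pos pi_pos hc) (hdiag' i)
    refine (two_div_one_sub_exp_neg_le ha).trans ?_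
    have hden : 0 < π * Real.sqrt 3 * c := by positivity
    have h1 : 1 / (π * c * Y i i) ≤ 2 / (π * Real.sqrt 3 * c) := by
      rw [div_le_div_iff₀ ha hden]
      have := hdiag i
      nlinarith [mul_pos pi_pos hc]
    linarith
  calc ∏ i, 2 / (1 - rexp (-(π * c * Y i i))) ≤ ∏ _i : Fin g, 2 * (1 + 2 / (π * Real.sqrt 3 * c)) :=
        Finset.prod_le_prod (fun i _ ↦ by
          have ha : 0 < π * c * Y i i := mul_pos (mul_pos pi_pos hc) (hdiag' i)
          have : rexp (-(π * c * Y i i)) < 1 := exp_lt_one_iff.mpr (by linarith)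
          positivity) (fun i _ ↦ hfac i)
    _ = (2 * (1 + 2 / (π * Real.sqrt 3 * c))) ^ g := by
        rw [Finset.prod_const, Finset.card_univ, Fintype.card_fin]

/-! ### The printed constant `2^{3g³+5g}` (appended) -/

/-- `g³ ≤ 2^{2g+1}` for every natural number `g`. [folklore] -/
theorem cube_le_two_pow (g : ℕ) : g ^ 3 ≤ 2 ^ (2 * g + 1) := by
  induction g with
  | zero => norm_num
  | succ n ih =>
    rcases Nat.lt_or_ge n 2 with h | h
    · have : n = 0 ∨ n = 1 := by omega
      rcases this with rfl | rfl <;> norm_num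
    · -- `(n+1)³ ≤ 4 n³ ≤ 4 · 2^{2n+1} = 2^{2(n+1)+1}`
      have h1 : (n + 1) ^ 3 ≤ 4 * n ^ 3 := by
        have h2 : 2 * 2 ≤ n * n := Nat.mul_le_mul h h
        have h3 : 2 * (n * n) ≤ n * (n * n) := Nat.mul_le_mul_right _ h
        nlinarith [h2, h3]
      calc (n + 1) ^ 3 ≤ 4 * n ^ 3 := h1
        _ ≤ 4 * 2 ^ (2 * n + 1) := by omega
        _ = 2 ^ (2 * (n + 1) + 1) := by ring

/-- **The constant of (2.4.2).** With Igusa's `c(g) = (4/g³)^{g-1} (3/4)^{g(g-1)/2}` (for `g ≥ 1`),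
`(2 (1 + 2/(π √3 c(g))))^g ≤ 2^{3g³ + 5g}` — the last step
"`≤ 2^g (1 + 2/(π√3 c(g)))^g`" `≤ 2^{3g³+5g}` of the proof of inequality (2.4.2).
[cite: Javanpeykar2014, Lemma 2.4.2 (proof, (2.4.2))] -/
theorem two_mul_one_add_pow_le {g : ℕ} (hg : 1 ≤ g) :
    (2 * (1 + 2 / (π * Real.sqrt 3 *
        ((4 / (g : ℝ) ^ 3) ^ (g - 1) * (3 / 4 : ℝ) ^ (g * (g - 1) / 2))))) ^ g ≤
      (2 : ℝ) ^ (3 * g ^ 3 + 5 * g) := by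
  have hg' : (1 : ℝ) ≤ g := by exact_mod_cast hg
  have hg0 : (0 : ℝ) < g := by linarith
  -- `u = 1/c(g) = (g³/4)^{g-1} (4/3)^{g(g-1)/2} ≤ 2^{3g²+3}`
  set m : ℕ := g * (g - 1) / 2 with hm
  set c : ℝ := (4 / (g : ℝ) ^ 3) ^ (g - 1) * (3 / 4 : ℝ) ^ m with hc
  have hc0 : 0 < c := by positivity
  have hu : 1 / c ≤ (2 : ℝ) ^ (3 * g ^ 2 + 3) := by
    have e1 : 1 / c = ((g : ℝ) ^ 3 / 4) ^ (g - 1) * (4 / 3 : ℝ) ^ m := by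
      rw [hc, one_div, mul_inv, ← inv_pow, ← inv_pow, inv_div, inv_div]
    rw [e1]
    have h1 : ((g : ℝ) ^ 3 / 4) ^ (g - 1) ≤ ((2 : ℝ) ^ (2 * g + 1)) ^ (g - 1) := by
      apply pow_le_pow_left₀ (by positivity)
      have : (g : ℝ) ^ 3 ≤ (2 : ℝ) ^ (2 * g + 1) := by exact_mod_cast cube_le_two_pow g
      linarith [pow_pos hg0 3]
    have h2 : (4 / 3 : ℝ) ^ m ≤ (2 : ℝ) ^ m := pow_le_pow_left₀ (by norm_num) (by norm_num) m
    have h3 : ((2 : ℝ) ^ (2 * g + 1)) ^ (g - 1) * (2 : ℝ) ^ m ≤ (2 : ℝ) ^ (3 * g ^ 2 + 3) := by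
      rw [← pow_mul, ← pow_add]
      apply pow_le_pow_right₀ (by norm_num)
      -- `(2g+1)(g-1) + g(g-1)/2 ≤ 3g² + 3`
      have hm2 : m ≤ g * g := by
        rw [hm]; exact (Nat.div_le_self _ _).trans (Nat.mul_le_mul_left g (Nat.sub_le g 1))
      have : (2 * g + 1) * (g - 1) ≤ 2 * g * g := by
        rcases g with _ | g
        · simp
        · simp only [Nat.add_sub_cancel]; nlinarith
      nlinarith
    calc ((g : ℝ) ^ 3 / 4) ^ (g - 1) * (4 / 3 : ℝ) ^ m
        ≤ ((2 : ℝ) ^ (2 * g + 1)) ^ (g - 1) * (2 : ℝ) ^ m :=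
          mul_le_mul h1 h2 (by positivity) (by positivity)
      _ ≤ (2 : ℝ) ^ (3 * g ^ 2 + 3) := h3
  -- each factor: `2 (1 + 2u/(π√3)) ≤ 2^{3g²+5}`
  have hπ3 : 4 ≤ π * Real.sqrt 3 := by
    have h3 : (17 / 10 : ℝ) ≤ Real.sqrt 3 := by
      rw [Real.le_sqrt (by norm_num) (by norm_num)]; norm_num
    nlinarith [pi_gt_three]
  have hfac : 2 * (1 + 2 / (π * Real.sqrt 3 * c)) ≤ (2 : ℝ) ^ (3 * g ^ 2 + 5) := by
    have h1 : 2 / (π * Real.sqrt 3 * c) ≤ 1 / 2 * (1 / c) := by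
      rw [div_le_iff₀ (by positivity)]
      have : 1 / 2 * (1 / c) * (π * Real.sqrt 3 * c) = 1 / 2 * (π * Real.sqrt 3) := by field_simp
      rw [this]
      nlinarith
    have h2 : (1 : ℝ) ≤ (2 : ℝ) ^ (3 * g ^ 2 + 3) := one_le_pow₀ (by norm_num)
    calc 2 * (1 + 2 / (π * Real.sqrt 3 * c)) ≤ 2 * (1 + 1 / 2 * (2 : ℝ) ^ (3 * g ^ 2 + 3)) := by
          nlinarith
      _ ≤ 2 * ((2 : ℝ) ^ (3 * g ^ 2 + 3) + (2 : ℝ) ^ (3 * g ^ 2 + 3)) := by nlinarith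
      _ = (2 : ℝ) ^ (3 * g ^ 2 + 5) := by ring
  calc (2 * (1 + 2 / (π * Real.sqrt 3 * c))) ^ g ≤ ((2 : ℝ) ^ (3 * g ^ 2 + 5)) ^ g :=
        pow_le_pow_left₀ (by positivity) hfac g
    _ = (2 : ℝ) ^ (3 * g ^ 3 + 5 * g) := by rw [← pow_mul]; ring_nf


/-- **Inequality (2.4.2) of Javanpeykar 2014, Lemma 2.4.2, with the printed constant.** For a real
`g × g` matrix `Y` with `ᵗm Y m ≥ c(g) Σᵢ mᵢ² Yᵢᵢ`, `c(g) = (4/g³)^{g-1}(3/4)^{g(g-1)/2}`, and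
`Yᵢᵢ ≥ √3/2` (Minkowski reduction, Igusa), and every `b ∈ ℝ^g`:
`Σ_{n ∈ ℤ^g} exp(-π ᵗ(n+b) Y (n+b)) ≤ 2^{3g³ + 5g}`. [cite: Javanpeykar2014, Lemma 2.4.2 (proof,
(2.4.2))] -/
theorem tsum_exp_neg_quadratic_le_two_pow {g : ℕ} (hg : 1 ≤ g) (Y : Matrix (Fin g) (Fin g) ℝ)
    (hY : ∀ m : Fin g → ℝ, (4 / (g : ℝ) ^ 3) ^ (g - 1) * (3 / 4 : ℝ) ^ (g * (g - 1) / 2) *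
      ∑ i, m i ^ 2 * Y i i ≤ ∑ i, ∑ j, m i * Y i j * m j)
    (hdiag : ∀ i, Real.sqrt 3 / 2 ≤ Y i i) (b : Fin g → ℝ) :
    ∑' n : Fin g → ℤ, rexp (-(π * ∑ i, ∑ j, ((n i : ℝ) + b i) * Y i j * ((n j : ℝ) + b j))) ≤
      (2 : ℝ) ^ (3 * g ^ 3 + 5 * g) := by
  have hg0 : (0 : ℝ) < g := by exact_mod_cast hg
  have hc : (0 : ℝ) < (4 / (g : ℝ) ^ 3) ^ (g - 1) * (3 / 4 : ℝ) ^ (g * (g - 1) / 2) := by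
    positivity
  exact (tsum_exp_neg_quadratic_le_pow Y hc hY hdiag b).trans (two_mul_one_add_pow_le hg)

end Literature.Analysis.SpecialFunctions

end
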